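import Literature.NumberTheory.EllipticCurves.SelmerCorankControlRatOrdinaryLayerUniformizerProofs
import Literature.NumberTheory.EllipticCurves.CyclotomicZpExtensionLayerGeneratorProofs
import Mathlib.RingTheory.Polynomial.Cyclotomic.Eval
import HarnessLib

/-!
# Greenberg's Lemma 3.4 at EVERY layer `n` of the cyclotomic `ℤ₂`-extension of `ℚ`, for `E/ℚ` good
# ordinary at `2`, modulo the layer's Kummer count (C1ₙ) alone — the uniformiser `2 - (ζ + ζ⁻¹)` of `(ℚ_n)_2`

`Proofs` file (theorems only: **no definition, no named fact, nothing asserted**) in topic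
`NumberTheory/EllipticCurves`, sequel of `SelmerCorankControlRatOrdinaryLayerUniformizerProofs`
(Lemma 3.4 at the layer `n` over `ℚ` modulo (C1ₙ) and a uniformiser-like `π`: `π` fixed by `H_{v,n}`,
`|π|^{d} = |p|`, `pⁿ ∣ d`; there `p = 2`, `n = 1`, `π = √2`). R. Greenberg, *Iwasawa theory for
elliptic curves*, LNM 1716 (1999), §3 Lemma 3.4 (p. 89); L. C. Washington, *Introduction to
Cyclotomic Fields*, §13.1 (`ℚ_n = ℚ(ζ_{2^{n+2}})⁺`) and Lemma 1.4 / Prop. 2.8 (`∏ (1 - ζ^a) = p`,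
`1 - ζ` generates the prime above `p`). **This file supplies `π` at every layer for `p = 2`:**

* `spectralValuation_one_sub_pow_totient_eq` (any number field `K`, `v ∣ p`): for a primitive
  `p^{m+1}`-th root of unity `ζ ∈ K̄_v`, `|1 - ζ|^{φ(p^{m+1})} = |p|` — all `1 - ζ^a` (`a` prime to `p`)
  have the same absolute value (`1 - ζ^a = (1 - ζ)(1 + ζ + ⋯)`) and their product over the primitive
  roots is `Φ_{p^{m+1}}(1) = p` (Mathlib `cyclotomic_eq_prod_X_sub_primitiveRoots`,
  `eval_one_cyclotomic_prime_pow`).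
* `spectralValuation_two_sub_add_inv_pow_eq` (`p = 2`): `π = 2 - (ζ + ζ⁻¹) = (1 - ζ)(1 - ζ⁻¹)` for a
  primitive `2^{n+2}`-th root `ζ` has `|π|^{2ⁿ} = |2|` (`φ(2^{n+2}) = 2^{n+1}`).
* `WeierstrassCurve.finite_localTowerKerPrimary_of_ordinary_two_of_count` — **for `W/ℚ` globally
  minimal with `2 ∤ Δ_W`, `2 ∤ a_2`, `κ` cyclotomic, `v ∋ 2` and ANY `n`: `𝒦_{v,n}[2^∞]` is finite as
  soon as the `E₁ ∩ E[2^k]`-valued cocycles of `H_{v,n}` fall into `≤ c₀ · 2^{2ⁿ k}` classes modulo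
  coboundaries of `2^k`-torsion points** ("`#H¹((ℚ_n)_2, C[2^k]) ≤ c₀ 2^{2ⁿk}`", corank `2ⁿ`):
  `π = ι(2 - (ζ + ζ⁻¹))` with `ζ + ζ⁻¹ ∈ ℚ_n` (`ZpExtension.IsCyclotomic.add_inv_mem_layer`) is fixed by
  `H_{v,n}` and `|π|^{2ⁿ} = |2|`; apply `finite_localTowerKerPrimary_of_ordinary_of_count_of_uniformizer`
  with `d = 2ⁿ`.

HONEST FRAMING (cell `bsd-f1-sign2`, WIDTH-5 attach seat `bsd-line-att-p5` g41 on crux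
stmt-BirchSwinnertonDyer-22298, lineage successor (i)/(ii)): conditional on (C1ₙ) (the Kummer count
over the ramified `(ℚ_n)_2`, OPEN in the tree for `n ≥ 1`); the named fact
`Greenberg1999.lemma34_natCard_localTowerKerPrimary_eq_rat` is NOT discharged; closes no item; BSD is
not proved by any of this.

## References

* [GreenbergLNM1716] R. Greenberg, LNM 1716 (1999), §3 Lemma 3.4 (p. 89), §2 Prop. 2.2 (p. 73).
* [Washington1997] L. C. Washington, *Introduction to Cyclotomic Fields*, §13.1, Lemma 1.4.

## Design

No definitions, no named facts; `noncomputable section`; one universe `u`. Axioms: `propext`,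
`Classical.choice`, `Quot.sound`.
-/

noncomputable section

open scoped Classical NNReal
open NumberField IsDedekindDomain Polynomial

universe u

/-! ## §1 `|1 - ζ|^{φ(p^{m+1})} = |p|` on `K̄_v` -/

namespace IsDedekindDomain.HeightOneSpectrum

open Literature.NumberTheory.EllipticCurves Literature.NumberTheory.GaloisRepresentations Field

variable {K : Type u} [Field K] [NumberField K] {v : HeightOneSpectrum (𝓞 K)}
  {p : ℕ} [hp : Fact p.Prime]
  {w : Valuation (AlgebraicClosure (v.adicCompletion K)) ℝ≥0}

/-- A root of unity has absolute value `1`. [folklore] -/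
private theorem val_rootOfUnity_eq_one' {ζ : AlgebraicClosure (v.adicCompletion K)} {N : ℕ} (hN : N ≠ 0)
    (hζ : ζ ^ N = 1) : w ζ = 1 := by
  have h : w ζ ^ N = 1 := by rw [← map_pow, hζ, map_one]
  exact (pow_eq_one_iff.mp h).resolve_right hN

/-- `|1 - ζ^a| ≤ |1 - ζ|` for `|ζ| ≤ 1` (`1 - ζ^a = (1 - ζ)(1 + ζ + ⋯ + ζ^{a-1})`). [folklore] -/
private theorem val_one_sub_pow_le_one_sub' {ζ : AlgebraicClosure (v.adicCompletion K)} (hζ : w ζ ≤ 1) (a : ℕ) :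
    w (1 - ζ ^ a) ≤ w (1 - ζ) := by
  rw [← mul_neg_geom_sum ζ a, map_mul]
  refine mul_le_of_le_one_right' (Valuation.map_sum_le _ fun i _ ↦ ?_)
  rw [map_pow]
  exact pow_le_one₀ zero_le hζ

/-- **`|1 - ζ|^{φ(p^{m+1})} = |p|` for a primitive `p^{m+1}`-th root of unity `ζ ∈ K̄_v`.** Every
primitive `p^{m+1}`-th root `μ` is a power of `ζ` and conversely, so `|1 - μ| = |1 - ζ|`; and
`∏_μ (1 - μ) = Φ_{p^{m+1}}(1) = p`. Washington, *Cyclotomic Fields*, Lemma 1.4 / Prop. 2.8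
(`(1 - ζ^a)/(1 - ζ)` is a unit; `p = ∏ (1 - ζ^a)`). [cite: Washington1997, Lemma 1.4] -/
theorem spectralValuation_one_sub_pow_totient_eq {m : ℕ} {ζ : AlgebraicClosure (v.adicCompletion K)}
    (hζ : IsPrimitiveRoot ζ (p ^ (m + 1))) :
    w (1 - ζ) ^ Nat.totient (p ^ (m + 1)) = w (p : AlgebraicClosure (v.adicCompletion K)) := by
  have hN : p ^ (m + 1) ≠ 0 := pow_ne_zero _ hp.out.ne_zero
  haveI : NeZero (p ^ (m + 1)) := ⟨hN⟩
  have hζ1 : w ζ = 1 := val_rootOfUnity_eq_one' hN hζ.pow_eq_one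
  -- all primitive roots `μ` have `|1 - μ| = |1 - ζ|`
  have hμ : ∀ μ ∈ primitiveRoots (p ^ (m + 1)) (AlgebraicClosure (v.adicCompletion K)),
      w (1 - μ) = w (1 - ζ) := by
    intro μ hμ
    have hμ' : IsPrimitiveRoot μ (p ^ (m + 1)) := isPrimitiveRoot_of_mem_primitiveRoots hμ
    have hμ1 : w μ = 1 := val_rootOfUnity_eq_one' hN hμ'.pow_eq_one
    obtain ⟨a, -, rfl⟩ := hζ.eq_pow_of_pow_eq_one hμ'.pow_eq_one
    refine le_antisymm (val_one_sub_pow_le_one_sub' hζ1.le a) ?_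
    obtain ⟨b, -, hb⟩ := hμ'.eq_pow_of_pow_eq_one hζ.pow_eq_one
    conv_lhs => rw [← hb]
    exact val_one_sub_pow_le_one_sub' hμ1.le b
  -- the product over the primitive roots is `Φ(1) = p`
  have hprod : ∏ μ ∈ primitiveRoots (p ^ (m + 1)) (AlgebraicClosure (v.adicCompletion K)), (1 - μ) =
      (p : AlgebraicClosure (v.adicCompletion K)) := by
    have h := congrArg (Polynomial.eval 1) (cyclotomic_eq_prod_X_sub_primitiveRoots hζ)
    rw [eval_one_cyclotomic_prime_pow, eval_prod] at h
    rw [h]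
    exact Finset.prod_congr rfl fun μ _ ↦ by rw [eval_sub, eval_X, eval_C]
  have h := congrArg w hprod
  rw [map_prod, Finset.prod_congr rfl hμ, Finset.prod_const, hζ.card_primitiveRoots] at h
  exact h

/-- **`|2 - (ζ + ζ⁻¹)|^{2ⁿ} = |2|` for a primitive `2^{n+2}`-th root of unity `ζ ∈ K̄_v`**:
`2 - (ζ + ζ⁻¹) = (1 - ζ)(1 - ζ⁻¹)`, both factors have absolute value `|1 - ζ|`, and
`|1 - ζ|^{2^{n+1}} = |2|` (`φ(2^{n+2}) = 2^{n+1}`). This is the uniformiser `π_n` of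
`(ℚ_n)_2 = ℚ₂(ζ_{2^{n+2}} + ζ_{2^{n+2}}⁻¹)`. [cite: Washington1997, §13.1] -/
theorem spectralValuation_two_sub_add_inv_pow_eq {n : ℕ} {ζ : AlgebraicClosure (v.adicCompletion K)}
    (hζ : IsPrimitiveRoot ζ (2 ^ (n + 2))) :
    w (2 - (ζ + ζ⁻¹)) ^ 2 ^ n = w ((2 : ℕ) : AlgebraicClosure (v.adicCompletion K)) := by
  haveI : Fact (Nat.Prime 2) := ⟨Nat.prime_two⟩
  have hN : 2 ^ (n + 2) ≠ 0 := pow_ne_zero _ two_ne_zero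
  haveI : NeZero (2 ^ (n + 2)) := ⟨hN⟩
  have hζ0 : ζ ≠ 0 := hζ.ne_zero hN
  have hζ1 : w ζ = 1 := val_rootOfUnity_eq_one' hN hζ.pow_eq_one
  -- `2 - (ζ + ζ⁻¹) = (1 - ζ) * (1 - ζ⁻¹)`
  have hfac : (2 : AlgebraicClosure (v.adicCompletion K)) - (ζ + ζ⁻¹) = (1 - ζ) * (1 - ζ⁻¹) := by
    field_simp
    ring
  -- `|1 - ζ⁻¹| = |1 - ζ|`
  have hinv : IsPrimitiveRoot ζ⁻¹ (2 ^ (n + 2)) := hζ.inv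
  have hinv1 : w ζ⁻¹ = 1 := val_rootOfUnity_eq_one' hN hinv.pow_eq_one
  have heq : w (1 - ζ⁻¹) = w (1 - ζ) := by
    obtain ⟨a, -, ha⟩ := hζ.eq_pow_of_pow_eq_one hinv.pow_eq_one
    obtain ⟨b, -, hb⟩ := hinv.eq_pow_of_pow_eq_one hζ.pow_eq_one
    refine le_antisymm ?_ ?_
    · rw [← ha]; exact val_one_sub_pow_le_one_sub' hζ1.le a
    · conv_lhs => rw [← hb]
      exact val_one_sub_pow_le_one_sub' hinv1.le b
  have htot : Nat.totient (2 ^ (n + 1 + 1)) = 2 ^ (n + 1) := by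
    rw [Nat.totient_prime_pow Nat.prime_two (Nat.succ_pos _)]
    simp
  have h1 := spectralValuation_one_sub_pow_totient_eq (v := v) (w := w) (p := 2) (m := n + 1) hζ
  rw [htot] at h1
  rw [hfac, map_mul, heq, ← sq, ← pow_mul, ← pow_succ', h1]

end IsDedekindDomain.HeightOneSpectrum

/-! ## §2 Lemma 3.4 at every layer of the cyclotomic `ℤ₂`-extension, modulo (C1ₙ) -/

namespace WeierstrassCurve

open Literature.NumberTheory.EllipticCurves Literature.NumberTheory.GaloisRepresentations Field
  IsDedekindDomain.HeightOneSpectrum Literature.NumberTheory.EllipticCurves.FormalGroupChart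
  Literature.NumberTheory.EllipticCurves.ResKernel

variable (W : WeierstrassCurve ℚ) [W.IsGloballyMinimal] [W.IsElliptic]
  {v : HeightOneSpectrum (𝓞 ℚ)}
  {w : Valuation (AlgebraicClosure (v.adicCompletion ℚ)) ℝ≥0}
  (hw : ∀ x, (w x : ℝ) = spectralNorm (v.adicCompletion ℚ) (AlgebraicClosure (v.adicCompletion ℚ)) x)

include hw in
/-- **Greenberg's Lemma 3.4 at the layer `n` of the cyclotomic `ℤ₂`-extension of `ℚ`, modulo the
Kummer count (C1ₙ) alone.** For a globally minimal `W/ℚ` with `2 ∤ Δ_W`, `2 ∤ a_2` (good ordinary at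
`2`), the cyclotomic `ℤ₂`-extension `κ`, `v ∋ 2` and any `n`: if for every `k` the continuous cocycles
of `H_{v,n} = (Γ_{ℚ_v} → Γ_ℚ)⁻¹(Gal(ℚ̄/ℚ_n))` with values in `E₁ ∩ E[2^k]` fall into at most
`c₀ · 2^{2ⁿ k}` classes modulo coboundaries of `2^k`-torsion points ("`H¹((ℚ_n)_2, C)` has corank
`2ⁿ`"), then `W.localTowerKerPrimary κ ℚ_v n` is finite. The uniformiser-like element is
`π_n = 2 - (ζ + ζ⁻¹)` for a primitive `2^{n+2}`-th root of unity `ζ`: `ζ + ζ⁻¹ ∈ ℚ_n`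
(`ZpExtension.IsCyclotomic.add_inv_mem_layer`), so its image in `K̄_v` is fixed by `H_{v,n}`, and
`|π_n|^{2ⁿ} = |2|` (`spectralValuation_two_sub_add_inv_pow_eq`); apply
`finite_localTowerKerPrimary_of_ordinary_of_count_of_uniformizer` with `d = 2ⁿ`. Greenberg, LNM 1716,
§3 Lemma 3.4 (p. 89); Washington §13.1. [cite: GreenbergLNM1716, §3 Lemma 3.4 (p. 89)]
[cite: Washington1997, §13.1] -/
theorem finite_localTowerKerPrimary_of_ordinary_two_of_count
    (hpv : ((2 : ℕ) : 𝓞 ℚ) ∈ v.asIdeal)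
    (hΔ : ¬ ((2 : ℕ) : ℤ) ∣ minimalDiscriminantInt W) (hord : ¬ ((2 : ℕ) : ℤ) ∣ W.frobeniusTrace 2)
    (κ : ZpExtension ℚ 2) (hκ : κ.IsCyclotomic) (n : ℕ)
    [hV : (W.baseChange (AlgebraicClosure (v.adicCompletion ℚ))).IsIntegral w.integer]
    {c₀ : ℕ}
    (hC1 : ∀ k : ℕ, ∃ S : Finset (contOneCocycles (discreteTopRep
      (localSubgroup (κ.layerSubgroup n) (v.adicCompletion ℚ)) (localPoints W (v.adicCompletion ℚ)))),
      S.card ≤ c₀ * 2 ^ (2 ^ n * k) ∧ ∀ ψ : contOneCocycles (discreteTopRep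
        (localSubgroup (κ.layerSubgroup n) (v.adicCompletion ℚ)) (localPoints W (v.adicCompletion ℚ))),
        (∀ g, 2 ^ k • ψ.1 g = 0) →
        (∀ g, ((ψ.1 g : localPoints W (v.adicCompletion ℚ)) :
          (W.baseChange (AlgebraicClosure (v.adicCompletion ℚ))).toAffine.Point) ∈
            kernel w (W.baseChange (AlgebraicClosure (v.adicCompletion ℚ)))) →
          ∃ ψ₀ ∈ S, ∃ t : localPoints W (v.adicCompletion ℚ), 2 ^ k • t = 0 ∧
            ∀ g, ψ.1 g - ψ₀.1 g = g • t - t) :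
    Finite (W.localTowerKerPrimary κ (v.adicCompletion ℚ) n) := by
  -- a primitive `2^{n+2}`-th root of unity in `ℚ̄`, `θ = ζ + ζ⁻¹ ∈ ℚ_n`
  haveI : NeZero (2 ^ (n + 2) : ℕ) := ⟨pow_ne_zero _ two_ne_zero⟩
  obtain ⟨ζ, hζ⟩ := HasEnoughRootsOfUnity.exists_primitiveRoot (AlgebraicClosure ℚ) (2 ^ (n + 2))
  have hθ : ζ + ζ⁻¹ ∈ κ.layer n := ZpExtension.IsCyclotomic.add_inv_mem_layer hκ n hζ
  have hθfix : ∀ σ' ∈ κ.layerSubgroup n,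
      (absoluteGaloisGroup.toAlgEquiv ℚ σ') (ζ + ζ⁻¹) = ζ + ζ⁻¹ := by
    intro σ' hσ'
    have hmem := hθ
    change ζ + ζ⁻¹ ∈ IntermediateField.fixedField _ at hmem
    rw [IntermediateField.mem_fixedField_iff] at hmem
    exact hmem _ ⟨σ', hσ', rfl⟩
  -- `π = ι(2 - θ) = 2 - (ιζ + (ιζ)⁻¹)`
  let ι := closureEmb (K := ℚ) (v.adicCompletion ℚ)
  let π : AlgebraicClosure (v.adicCompletion ℚ) := ι (2 - (ζ + ζ⁻¹))
  have hπH : ∀ σ ∈ localSubgroup (κ.layerSubgroup n) (v.adicCompletion ℚ), σ • π = π := by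
    intro σ hσ
    rw [mem_localSubgroup_iff] at hσ
    have h := apply_resGalAuxOfEmb_apply (closureEmb (K := ℚ) (v.adicCompletion ℚ)) σ (2 - (ζ + ζ⁻¹))
    have hfix : (absoluteGaloisGroup.toAlgEquiv ℚ (resGal (K := ℚ) (v.adicCompletion ℚ) σ))
        (2 - (ζ + ζ⁻¹)) = 2 - (ζ + ζ⁻¹) := by
      rw [map_sub, map_ofNat, hθfix _ hσ]
    change closureEmb (K := ℚ) (v.adicCompletion ℚ)
      ((absoluteGaloisGroup.toAlgEquiv ℚ (resGal (K := ℚ) (v.adicCompletion ℚ) σ))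
        (2 - (ζ + ζ⁻¹))) = σ • π at h
    rw [hfix] at h
    exact h.symm
  have hζ' : IsPrimitiveRoot (ι ζ) (2 ^ (n + 2)) := hζ.map_of_injective ι.injective
  have hπ : w π ^ 2 ^ n = w ((2 : ℕ) : AlgebraicClosure (v.adicCompletion ℚ)) := by
    have e : π = 2 - (ι ζ + (ι ζ)⁻¹) := by
      change ι (2 - (ζ + ζ⁻¹)) = _
      rw [map_sub, map_ofNat, map_add, map_inv₀]
    rw [e]
    exact spectralValuation_two_sub_add_inv_pow_eq hζ'
  exact W.finite_localTowerKerPrimary_of_ordinary_of_count_of_uniformizer hw hpv hΔ hord κ hκ n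
    (d := 2 ^ n) hC1 hπH hπ dvd_rfl

end WeierstrassCurve
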